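import Literature.Computability.QuantumComplexity.RazTalBoundedDepth
import Mathlib.Analysis.Calculus.Deriv.Pi
import Mathlib.Analysis.SpecialFunctions.Trigonometric.Deriv
import HarnessLib

/-!
# The Gaussian Poincaré inequality by the rotation (interpolation) argument

`Literature/Probability/Distributions/`. For the product Gaussian `γ = 𝒩(0, v I_n)` on `ℝ^n`
(Mathlib: `Measure.pi fun _ : Fin n => gaussianReal 0 v`) and a `C¹` function `φ : ℝ^n → ℝ`,

  `∫∫ (φ x - φ y)² dγ(x) dγ(y) ≤ (π²/4) v ∫ |∇φ|² dγ`,   `|∇φ|² = ∑ᵢ (∂ᵢφ)²`,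

stated with Lebesgue integrals in `[0, ∞]` (no integrability hypotheses) —
`lintegral_sq_sub_le_pi_gaussianReal`. Since `∫∫ (φ x - φ y)² = 2 Var_γ(φ)` for `φ ∈ L²(γ)`,
this is the Gaussian Poincaré inequality `Var_γ(φ) ≤ C v ∫|∇φ|² dγ` with the (non-optimal,
dimension-free) constant `C = π²/8` instead of `1`.

Proof (the classical interpolation along rotations — Pisier's argument for Gaussian Poincaré and
concentration inequalities, using only the rotation invariance of `γ ⊗ γ`; recorded as folklore):
for `x, y ∈ ℝ^n` put
`x_θ = cos θ · x + sin θ · y`, `x'_θ = -sin θ · x + cos θ · y`; then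
`φ(y) - φ(x) = ∫₀^{π/2} ⟨∇φ(x_θ), x'_θ⟩ dθ`, so `(φ y - φ x)² ≤ (π/2)∫₀^{π/2} ⟨∇φ(x_θ), x'_θ⟩² dθ`
(Cauchy–Schwarz); for each `θ` the map `(x, y) ↦ (x_θ, x'_θ)` is a rotation of `ℝ^n × ℝ^n` and
preserves `γ ⊗ γ` (`pi_gaussianReal_prod_map_rotate`, from the orthogonal invariance
`pi_gaussianReal_map_mulVec` of `𝒩(0, I)` in `ℝ^{[n] ⊔ [n]}` and scaling), whence
`∫∫ ⟨∇φ(x_θ), x'_θ⟩² dγdγ = ∫∫ ⟨∇φ(x), y⟩² dγ(x)dγ(y) = v ∫ |∇φ|² dγ` (second moments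
`∫ yᵢyⱼ dγ = v δᵢⱼ`, `integral_eval_mul_eval_pi_gaussianReal`), and Tonelli in `θ` gives the claim.

No definitions. The rotation matrix `rotBlocks` and the invariances `pi_gaussianReal_map_mulVec`,
`integral_sq_gaussianReal` are reused from `Literature/Computability/QuantumComplexity/`
(Raz–Tal files), where they were first needed.
-/

noncomputable section

open MeasureTheory ProbabilityTheory Filter Set
open scoped ENNReal NNReal Topology

namespace Literature.Probability.Distributions

open Literature.Computability.QuantumComplexity

variable {n : ℕ}

/-! ### Rotation invariance of `𝒩(0, v I_n) ⊗ 𝒩(0, v I_n)` -/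

/-- The second block of the rotated vector is `-b x + a x'`. [folklore] -/
theorem rotBlocks_mulVec_inr (N : ℕ) (a b : ℝ) (w : Fin N ⊕ Fin N → ℝ) (i : Fin N) :
    (rotBlocks N a b).mulVec w (Sum.inr i) = -b * w (Sum.inl i) + a * w (Sum.inr i) := by
  unfold rotBlocks
  rw [Matrix.fromBlocks_mulVec, Sum.elim_inr]
  simp [Matrix.smul_mulVec, Matrix.one_mulVec, Matrix.neg_mulVec]

/-- **Rotation invariance of `𝒩(0, I_n) ⊗ 𝒩(0, I_n)`**: for `a² + b² = 1` the rotation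
`(x, y) ↦ (a x + b y, -b x + a y)` of `ℝ^n × ℝ^n` preserves the product of two standard
Gaussians. [folklore] -/
theorem stdGaussianPi_prod_map_rotate (N : ℕ) {a b : ℝ} (hab : a ^ 2 + b ^ 2 = 1) :
    ((stdGaussianPi N).prod (stdGaussianPi N)).map
        (fun q => (a • q.1 + b • q.2, (-b) • q.1 + a • q.2)) =
      (stdGaussianPi N).prod (stdGaussianPi N) := by
  set μ2 : Measure (Fin N ⊕ Fin N → ℝ) := Measure.pi fun _ => gaussianReal 0 1 with hμ2
  have hpres := measurePreserving_sumPiEquivProdPi (fun _ : Fin N ⊕ Fin N => gaussianReal 0 1)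
  have hprod : (stdGaussianPi N).prod (stdGaussianPi N) =
      μ2.map (MeasurableEquiv.sumPiEquivProdPi fun _ : Fin N ⊕ Fin N => ℝ) := by
    rw [hpres.map_eq]; rfl
  rw [hprod, Measure.map_map (by fun_prop) (MeasurableEquiv.measurable _)]
  have hcomp : (fun q : (Fin N → ℝ) × (Fin N → ℝ) => (a • q.1 + b • q.2, (-b) • q.1 + a • q.2)) ∘
      (MeasurableEquiv.sumPiEquivProdPi fun _ : Fin N ⊕ Fin N => ℝ) =
      (MeasurableEquiv.sumPiEquivProdPi fun _ : Fin N ⊕ Fin N => ℝ) ∘ (rotBlocks N a b).mulVec := by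
    funext w
    refine Prod.ext (funext fun i => ?_) (funext fun i => ?_)
    · simp only [Function.comp_apply, Pi.add_apply, Pi.smul_apply, smul_eq_mul]
      rw [show (MeasurableEquiv.sumPiEquivProdPi (fun _ : Fin N ⊕ Fin N => ℝ)
        ((rotBlocks N a b).mulVec w)).1 i = (rotBlocks N a b).mulVec w (Sum.inl i) from rfl,
        rotBlocks_mulVec_inl]
      rfl
    · simp only [Function.comp_apply, Pi.add_apply, Pi.smul_apply, smul_eq_mul]
      rw [show (MeasurableEquiv.sumPiEquivProdPi (fun _ : Fin N ⊕ Fin N => ℝ)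
        ((rotBlocks N a b).mulVec w)).2 i = (rotBlocks N a b).mulVec w (Sum.inr i) from rfl,
        rotBlocks_mulVec_inr]
      rfl
  rw [hcomp, ← Measure.map_map (MeasurableEquiv.measurable _) (Continuous.measurable (by fun_prop)),
    hμ2, pi_gaussianReal_map_mulVec _ (rotBlocks_transpose_mul_self N hab)]

/-- `𝒩(0, v I_n)` is the image of `𝒩(0, I_n)` under `x ↦ √v · x`. [folklore] -/
theorem pi_gaussianReal_eq_map_sqrt_smul (N : ℕ) (v : ℝ≥0) :
    (Measure.pi fun _ : Fin N => gaussianReal 0 v) =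
      (stdGaussianPi N).map (fun x => Real.sqrt v • x) := by
  unfold stdGaussianPi
  have e : (fun x : Fin N → ℝ => Real.sqrt v • x) = fun x i => Real.sqrt v * x i := by
    funext x; funext i; rfl
  rw [e, Measure.pi_map_pi (f := fun (_ : Fin N) (t : ℝ) => Real.sqrt v * t) fun _ => by fun_prop]
  congr 1
  funext i
  rw [gaussianReal_map_const_mul, mul_zero]
  congr 1
  ext
  simp [Real.sq_sqrt v.coe_nonneg]

/-- **Rotation invariance of `𝒩(0, v I_n) ⊗ 𝒩(0, v I_n)`** (`a² + b² = 1`). [folklore] -/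
theorem pi_gaussianReal_prod_map_rotate (N : ℕ) (v : ℝ≥0) {a b : ℝ} (hab : a ^ 2 + b ^ 2 = 1) :
    ((Measure.pi fun _ : Fin N => gaussianReal 0 v).prod (Measure.pi fun _ : Fin N => gaussianReal 0 v)).map
        (fun q => (a • q.1 + b • q.2, (-b) • q.1 + a • q.2)) =
      (Measure.pi fun _ : Fin N => gaussianReal 0 v).prod (Measure.pi fun _ : Fin N => gaussianReal 0 v) := by
  have hS : Measurable fun x : Fin N → ℝ => Real.sqrt v • x := by fun_prop
  have hR : Measurable fun q : (Fin N → ℝ) × (Fin N → ℝ) => (a • q.1 + b • q.2, (-b) • q.1 + a • q.2) := by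
    fun_prop
  rw [pi_gaussianReal_eq_map_sqrt_smul, Measure.map_prod_map _ _ hS hS, Measure.map_map hR (hS.prodMap hS)]
  have hcomm : (fun q : (Fin N → ℝ) × (Fin N → ℝ) => (a • q.1 + b • q.2, (-b) • q.1 + a • q.2)) ∘
      Prod.map (fun x : Fin N → ℝ => Real.sqrt v • x) (fun x : Fin N → ℝ => Real.sqrt v • x) =
      Prod.map (fun x : Fin N → ℝ => Real.sqrt v • x) (fun x : Fin N → ℝ => Real.sqrt v • x) ∘
        (fun q : (Fin N → ℝ) × (Fin N → ℝ) => (a • q.1 + b • q.2, (-b) • q.1 + a • q.2)) := by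
    funext q
    show (a • (Real.sqrt v • q.1) + b • (Real.sqrt v • q.2),
        (-b) • (Real.sqrt v • q.1) + a • (Real.sqrt v • q.2)) =
      (Real.sqrt v • (a • q.1 + b • q.2), Real.sqrt v • ((-b) • q.1 + a • q.2))
    simp only [smul_add, smul_smul]
    rw [mul_comm a, mul_comm b, mul_comm (-b)]
  rw [hcomm, ← Measure.map_map (hS.prodMap hS) hR, stdGaussianPi_prod_map_rotate N hab]

/-! ### Second moments of `𝒩(0, v I_n)` -/

/-- **Second moments of the product Gaussian**: `∫ yᵢ yⱼ d𝒩(0, v I_n) = v δᵢⱼ`. [folklore] -/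
theorem integral_eval_mul_eval_pi_gaussianReal (v : ℝ≥0) (i j : Fin n) :
    ∫ y, y i * y j ∂(Measure.pi fun _ : Fin n => gaussianReal 0 v) = if i = j then (v : ℝ) else 0 := by
  classical
  by_cases hij : i = j
  · subst hij
    have e : ∀ y : Fin n → ℝ, y i * y i = ∏ k, (if k = i then y k ^ 2 else 1) := by
      intro y
      rw [Finset.prod_ite_eq' Finset.univ i (fun k => y k ^ 2), if_pos (Finset.mem_univ _), sq]
    rw [if_pos rfl]
    simp_rw [e]
    rw [integral_fintype_prod_eq_prod (f := fun (k : Fin n) (t : ℝ) => if k = i then t ^ 2 else 1)]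
    have e2 : ∀ k : Fin n, (∫ t, (if k = i then t ^ 2 else (1 : ℝ)) ∂(gaussianReal 0 v)) =
        if k = i then (v : ℝ) else 1 := by
      intro k
      split_ifs
      · exact integral_sq_gaussianReal v
      · simp
    simp_rw [e2]
    rw [Finset.prod_ite_eq' Finset.univ i (fun _ => (v : ℝ))]
    simp
  · rw [if_neg hij]
    have e : ∀ y : Fin n → ℝ, y i * y j =
        ∏ k, ((if k = i then y k else 1) * (if k = j then y k else 1)) := by
      intro y
      rw [Finset.prod_mul_distrib, Finset.prod_ite_eq' Finset.univ i (fun k => y k),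
        Finset.prod_ite_eq' Finset.univ j (fun k => y k)]
      simp
    simp_rw [e]
    rw [integral_fintype_prod_eq_prod
      (f := fun (k : Fin n) (t : ℝ) => (if k = i then t else 1) * (if k = j then t else 1))]
    refine Finset.prod_eq_zero (Finset.mem_univ i) ?_
    have e1 : (fun t : ℝ => (if i = i then t else 1) * (if i = j then t else 1)) = fun t => t := by
      funext t; rw [if_pos rfl, if_neg hij, mul_one]
    rw [e1]
    exact integral_id_gaussianReal

/-- Coordinates are square integrable under `𝒩(0, v I_n)`, products `yᵢyⱼ` are integrable. [folklore] -/
theorem integrable_eval_mul_eval_pi_gaussianReal (v : ℝ≥0) (i j : Fin n) :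
    Integrable (fun y : Fin n → ℝ => y i * y j) (Measure.pi fun _ : Fin n => gaussianReal 0 v) := by
  have h2 : ∀ k : Fin n, MemLp (fun y : Fin n → ℝ => y k) 2 (Measure.pi fun _ : Fin n => gaussianReal 0 v) := by
    intro k
    have h := (memLp_id_gaussianReal (μ := 0) (v := v) 2)
    have hk := h.comp_measurePreserving (measurePreserving_eval (fun _ : Fin n => gaussianReal 0 v) k)
    exact hk
  exact (h2 i).integrable_mul (h2 j)

/-- **`∫ ⟨u, y⟩² d𝒩(0, v I_n)(y) = v |u|²`.** [folklore] -/
theorem integral_sq_sum_mul_pi_gaussianReal (v : ℝ≥0) (u : Fin n → ℝ) :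
    ∫ y, (∑ i, u i * y i) ^ 2 ∂(Measure.pi fun _ : Fin n => gaussianReal 0 v) = v * ∑ i, u i ^ 2 := by
  set G := Measure.pi fun _ : Fin n => gaussianReal 0 v with hG
  have e : ∀ y : Fin n → ℝ, (∑ i, u i * y i) ^ 2 = ∑ i, ∑ j, (u i * u j) * (y i * y j) := by
    intro y
    rw [sq, Finset.sum_mul_sum]
    refine Finset.sum_congr rfl fun i _ => Finset.sum_congr rfl fun j _ => by ring
  simp_rw [e]
  rw [integral_finsetSum _ fun i _ => integrable_finsetSum _ fun j _ =>
    (integrable_eval_mul_eval_pi_gaussianReal v i j).const_mul _]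
  simp_rw [integral_finsetSum _ fun j _ => (integrable_eval_mul_eval_pi_gaussianReal v _ j).const_mul _,
    integral_const_mul, integral_eval_mul_eval_pi_gaussianReal, mul_ite, mul_zero]
  simp_rw [Finset.sum_ite_eq, Finset.mem_univ, if_true]
  rw [Finset.mul_sum]
  refine Finset.sum_congr rfl fun i _ => by ring

/-- The square `⟨u, y⟩²` is integrable under `𝒩(0, v I_n)`. [folklore] -/
theorem integrable_sq_sum_mul_pi_gaussianReal (v : ℝ≥0) (u : Fin n → ℝ) :
    Integrable (fun y : Fin n → ℝ => (∑ i, u i * y i) ^ 2) (Measure.pi fun _ : Fin n => gaussianReal 0 v) := by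
  have e : (fun y : Fin n → ℝ => (∑ i, u i * y i) ^ 2) =
      fun y => ∑ i, ∑ j, (u i * u j) * (y i * y j) := by
    funext y
    rw [sq, Finset.sum_mul_sum]
    refine Finset.sum_congr rfl fun i _ => Finset.sum_congr rfl fun j _ => by ring
  rw [e]
  exact integrable_finsetSum _ fun i _ => integrable_finsetSum _ fun j _ =>
    (integrable_eval_mul_eval_pi_gaussianReal v i j).const_mul _

/-! ### The interpolation argument -/

/-- Cauchy–Schwarz on an interval: `(∫ₐᵇ g)² ≤ (b - a) ∫ₐᵇ g²` (`a ≤ b`, `g` continuous). [folklore] -/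
theorem sq_intervalIntegral_le_mul {g : ℝ → ℝ} (hg : Continuous g) {a b : ℝ} (hab : a ≤ b) :
    (∫ s in a..b, g s) ^ 2 ≤ (b - a) * ∫ s in a..b, g s ^ 2 := by
  rcases hab.eq_or_lt with h | hab'
  · subst h; simp
  have hτ : 0 < b - a := sub_pos.2 hab'
  set I := ∫ s in a..b, g s with hI
  set Q := ∫ s in a..b, g s ^ 2 with hQ
  have h0 : 0 ≤ ∫ s in a..b, (g s - I / (b - a)) ^ 2 :=
    intervalIntegral.integral_nonneg hab fun s _ => sq_nonneg _
  have hi1 : IntervalIntegrable (fun s => g s ^ 2) volume a b := (hg.pow 2).intervalIntegrable _ _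
  have hi2 : IntervalIntegrable (fun s => 2 * (I / (b - a)) * g s) volume a b :=
    (continuous_const.mul hg).intervalIntegrable _ _
  have hi3 : IntervalIntegrable (fun _ : ℝ => (I / (b - a)) ^ 2) volume a b :=
    continuous_const.intervalIntegrable _ _
  have h1 : ∫ s in a..b, (g s - I / (b - a)) ^ 2 =
      Q - 2 * (I / (b - a)) * I + (b - a) * (I / (b - a)) ^ 2 := by
    have e : (fun s => (g s - I / (b - a)) ^ 2) =
        fun s => (g s ^ 2 - 2 * (I / (b - a)) * g s) + (I / (b - a)) ^ 2 := by
      funext s; ring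
    rw [e, intervalIntegral.integral_add (hi1.sub hi2) hi3, intervalIntegral.integral_sub hi1 hi2,
      intervalIntegral.integral_const_mul, intervalIntegral.integral_const, smul_eq_mul]
  rw [h1] at h0
  have h2 : Q - 2 * (I / (b - a)) * I + (b - a) * (I / (b - a)) ^ 2 = Q - I ^ 2 / (b - a) := by
    field_simp
    ring
  rw [h2] at h0
  have h3 : I ^ 2 / (b - a) ≤ Q := by linarith
  rwa [div_le_iff₀ hτ, mul_comm] at h3

/-- The interpolation path `x_θ = cos θ · x + sin θ · y` and its derivative
`x'_θ = -sin θ · x + cos θ · y`: `d/dθ φ(x_θ) = Dφ(x_θ) x'_θ`. [folklore] -/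
theorem hasDerivAt_comp_rotatePath {φ : (Fin n → ℝ) → ℝ} (hφ : Differentiable ℝ φ)
    (x y : Fin n → ℝ) (θ : ℝ) :
    HasDerivAt (fun θ => φ (Real.cos θ • x + Real.sin θ • y))
      (fderiv ℝ φ (Real.cos θ • x + Real.sin θ • y) ((-Real.sin θ) • x + Real.cos θ • y)) θ := by
  have hp : HasDerivAt (fun θ => Real.cos θ • x + Real.sin θ • y)
      ((-Real.sin θ) • x + Real.cos θ • y) θ :=
    ((Real.hasDerivAt_cos θ).smul_const x).add ((Real.hasDerivAt_sin θ).smul_const y)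
  exact (hφ _).hasFDerivAt.comp_hasDerivAt θ hp

/-- **Pointwise interpolation bound**: for `φ ∈ C¹`,
`(φ y - φ x)² ≤ (π/2) ∫₀^{π/2} (Dφ(x_θ) x'_θ)² dθ`. [folklore] -/
theorem sq_sub_le_integral_rotatePath {φ : (Fin n → ℝ) → ℝ} (hφ : ContDiff ℝ 1 φ)
    (x y : Fin n → ℝ) :
    (φ y - φ x) ^ 2 ≤ (Real.pi / 2) * ∫ θ in (0 : ℝ)..(Real.pi / 2),
      (fderiv ℝ φ (Real.cos θ • x + Real.sin θ • y) ((-Real.sin θ) • x + Real.cos θ • y)) ^ 2 := by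
  have hd : Differentiable ℝ φ := hφ.differentiable one_ne_zero
  have hcont : Continuous fun θ : ℝ =>
      fderiv ℝ φ (Real.cos θ • x + Real.sin θ • y) ((-Real.sin θ) • x + Real.cos θ • y) := by
    have h1 : Continuous (fderiv ℝ φ) := hφ.continuous_fderiv one_ne_zero
    exact (h1.comp (by fun_prop)).clm_apply (by fun_prop)
  have hftc : ∫ θ in (0 : ℝ)..(Real.pi / 2),
      fderiv ℝ φ (Real.cos θ • x + Real.sin θ • y) ((-Real.sin θ) • x + Real.cos θ • y) =
      φ y - φ x := by
    rw [intervalIntegral.integral_eq_sub_of_hasDerivAt (fun θ _ => hasDerivAt_comp_rotatePath hd x y θ)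
      (hcont.intervalIntegrable _ _)]
    simp
  rw [← hftc]
  have h := sq_intervalIntegral_le_mul hcont (a := 0) (b := Real.pi / 2) (by positivity)
  simpa using h

/-- `Dφ(x) y = ∑ᵢ yᵢ ∂ᵢφ(x)` (linearity of the derivative in the direction). [folklore] -/
theorem fderiv_apply_eq_sum_mul_single (φ : (Fin n → ℝ) → ℝ) (x y : Fin n → ℝ) :
    fderiv ℝ φ x y = ∑ i, fderiv ℝ φ x (Pi.single i 1) * y i := by
  conv_lhs => rw [← Finset.univ_sum_single y]
  rw [map_sum]
  refine Finset.sum_congr rfl fun i _ => ?_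
  have e : (Pi.single i (y i) : Fin n → ℝ) = y i • (Pi.single i (1 : ℝ) : Fin n → ℝ) := by
    ext j
    by_cases h : j = i
    · subst h; simp
    · simp [Pi.single_eq_of_ne h]
  rw [e, map_smul, smul_eq_mul, mul_comm]

/-- Measurability of `(x, y) ↦ (Dφ(x) y)²` for `φ ∈ C¹`. [folklore] -/
theorem measurable_ofReal_sq_fderiv {φ : (Fin n → ℝ) → ℝ} (hφ : ContDiff ℝ 1 φ) :
    Measurable fun z : (Fin n → ℝ) × (Fin n → ℝ) => ENNReal.ofReal ((fderiv ℝ φ z.1 z.2) ^ 2) := by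
  refine ENNReal.measurable_ofReal.comp (Continuous.measurable ?_)
  exact (((hφ.continuous_fderiv one_ne_zero).comp continuous_fst).clm_apply continuous_snd).pow 2

/-- The rotation step: for every angle `θ`,
`∫∫ (Dφ(x_θ) x'_θ)² dγdγ = ∫∫ (Dφ(x) y)² dγ(x)dγ(y)`. [folklore] -/
theorem lintegral_sq_fderiv_rotatePath (v : ℝ≥0) {φ : (Fin n → ℝ) → ℝ} (hφ : ContDiff ℝ 1 φ) (θ : ℝ) :
    ∫⁻ z, ENNReal.ofReal ((fderiv ℝ φ (Real.cos θ • z.1 + Real.sin θ • z.2)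
        ((-Real.sin θ) • z.1 + Real.cos θ • z.2)) ^ 2)
        ∂((Measure.pi fun _ : Fin n => gaussianReal 0 v).prod (Measure.pi fun _ : Fin n => gaussianReal 0 v)) =
      ∫⁻ z, ENNReal.ofReal ((fderiv ℝ φ z.1 z.2) ^ 2)
        ∂((Measure.pi fun _ : Fin n => gaussianReal 0 v).prod (Measure.pi fun _ : Fin n => gaussianReal 0 v)) := by
  have hrot := pi_gaussianReal_prod_map_rotate n v (a := Real.cos θ) (b := Real.sin θ)
    (by rw [Real.cos_sq_add_sin_sq])
  have hR : Measurable fun q : (Fin n → ℝ) × (Fin n → ℝ) =>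
      (Real.cos θ • q.1 + Real.sin θ • q.2, (-Real.sin θ) • q.1 + Real.cos θ • q.2) := by fun_prop
  have h := lintegral_map (measurable_ofReal_sq_fderiv hφ) hR
    (μ := (Measure.pi fun _ : Fin n => gaussianReal 0 v).prod (Measure.pi fun _ : Fin n => gaussianReal 0 v))
  rw [hrot] at h
  exact h.symm

/-- The second-moment step: `∫∫ (Dφ(x) y)² dγ(x)dγ(y) = v ∫ ∑ᵢ (∂ᵢφ)² dγ`. [folklore] -/
theorem lintegral_sq_fderiv_prod (v : ℝ≥0) {φ : (Fin n → ℝ) → ℝ} (hφ : ContDiff ℝ 1 φ) :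
    ∫⁻ z, ENNReal.ofReal ((fderiv ℝ φ z.1 z.2) ^ 2)
        ∂((Measure.pi fun _ : Fin n => gaussianReal 0 v).prod (Measure.pi fun _ : Fin n => gaussianReal 0 v)) =
      ENNReal.ofReal v * ∫⁻ x, ENNReal.ofReal (∑ i, (fderiv ℝ φ x (Pi.single i 1)) ^ 2)
        ∂(Measure.pi fun _ : Fin n => gaussianReal 0 v) := by
  set G : Measure (Fin n → ℝ) := Measure.pi fun _ : Fin n => gaussianReal 0 v with hG
  have hm : Measurable fun x : Fin n → ℝ => ENNReal.ofReal (∑ i, (fderiv ℝ φ x (Pi.single i 1)) ^ 2) := by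
    refine ENNReal.measurable_ofReal.comp (Continuous.measurable ?_)
    exact continuous_finsetSum _ fun i _ =>
      ((hφ.continuous_fderiv one_ne_zero).clm_apply continuous_const).pow 2
  rw [lintegral_prod _ (measurable_ofReal_sq_fderiv hφ).aemeasurable, ← lintegral_const_mul _ hm]
  refine lintegral_congr fun x => ?_
  have e : ∫⁻ y, ENNReal.ofReal ((fderiv ℝ φ x y) ^ 2) ∂G =
      ∫⁻ y, ENNReal.ofReal ((∑ i, fderiv ℝ φ x (Pi.single i 1) * y i) ^ 2) ∂G :=
    lintegral_congr fun y => by rw [fderiv_apply_eq_sum_mul_single]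
  rw [e, ← ofReal_integral_eq_lintegral_ofReal (integrable_sq_sum_mul_pi_gaussianReal v _)
    (ae_of_all _ fun y => sq_nonneg _), integral_sq_sum_mul_pi_gaussianReal,
    ENNReal.ofReal_mul v.coe_nonneg]

/-- **The Gaussian Poincaré inequality, interpolation form.** For `φ ∈ C¹(ℝ^n)` and
`γ = 𝒩(0, v I_n)`:
`∫∫ (φ x - φ y)² dγ(x)dγ(y) ≤ (π²/4) v ∫ ∑ᵢ (∂ᵢφ)² dγ` (Lebesgue integrals in `[0, ∞]`; the
left side is `2 Var_γ(φ)` when `φ ∈ L²(γ)`; the constant is dimension-free). [folklore] -/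
theorem lintegral_sq_sub_le_pi_gaussianReal (v : ℝ≥0) {φ : (Fin n → ℝ) → ℝ} (hφ : ContDiff ℝ 1 φ) :
    ∫⁻ x, ∫⁻ y, ENNReal.ofReal ((φ x - φ y) ^ 2) ∂(Measure.pi fun _ : Fin n => gaussianReal 0 v)
        ∂(Measure.pi fun _ : Fin n => gaussianReal 0 v) ≤
      ENNReal.ofReal (Real.pi ^ 2 / 4 * v) *
        ∫⁻ x, ENNReal.ofReal (∑ i, (fderiv ℝ φ x (Pi.single i 1)) ^ 2)
          ∂(Measure.pi fun _ : Fin n => gaussianReal 0 v) := by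
  set G : Measure (Fin n → ℝ) := Measure.pi fun _ : Fin n => gaussianReal 0 v with hG
  -- the integrand after differentiation along the path (kept opaque)
  obtain ⟨K, hK⟩ : ∃ K : (Fin n → ℝ) × (Fin n → ℝ) → ℝ → ℝ, ∀ z θ, K z θ =
      (fderiv ℝ φ (Real.cos θ • z.1 + Real.sin θ • z.2) ((-Real.sin θ) • z.1 + Real.cos θ • z.2)) ^ 2 :=
    ⟨_, fun z θ => rfl⟩
  have hK₂ : ∀ (x y : Fin n → ℝ) (θ : ℝ), K (x, y) θ =
      (fderiv ℝ φ (Real.cos θ • x + Real.sin θ • y) ((-Real.sin θ) • x + Real.cos θ • y)) ^ 2 :=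
    fun x y θ => hK (x, y) θ
  have hKc : Continuous (Function.uncurry K) := by
    have h1 : Continuous (fderiv ℝ φ) := hφ.continuous_fderiv one_ne_zero
    have e : Function.uncurry K = fun p : ((Fin n → ℝ) × (Fin n → ℝ)) × ℝ =>
        (fderiv ℝ φ (Real.cos p.2 • p.1.1 + Real.sin p.2 • p.1.2)
          ((-Real.sin p.2) • p.1.1 + Real.cos p.2 • p.1.2)) ^ 2 := by
      funext p; exact hK p.1 p.2
    rw [e]
    exact ((h1.comp (by fun_prop)).clm_apply (by fun_prop)).pow 2
  have hK0 : ∀ z θ, 0 ≤ K z θ := fun z θ => by rw [hK]; exact sq_nonneg _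
  have hpi2 : (0 : ℝ) ≤ Real.pi / 2 := by positivity
  have hKm : Measurable fun p : ((Fin n → ℝ) × (Fin n → ℝ)) × ℝ => ENNReal.ofReal (K p.1 p.2) :=
    ENNReal.measurable_ofReal.comp hKc.measurable
  -- Step 1: pointwise bound, in `ℝ≥0∞`
  have h1 : ∀ x y : Fin n → ℝ, ENNReal.ofReal ((φ x - φ y) ^ 2) ≤
      ENNReal.ofReal (Real.pi / 2) * ∫⁻ θ in Ioc 0 (Real.pi / 2), ENNReal.ofReal (K (x, y) θ) := by
    intro x y
    have hc : Continuous fun θ => K (x, y) θ := hKc.comp (Continuous.prodMk_right (x, y))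
    have h := sq_sub_le_integral_rotatePath hφ x y
    simp_rw [← hK₂] at h
    rw [show (φ x - φ y) ^ 2 = (φ y - φ x) ^ 2 by ring]
    calc ENNReal.ofReal ((φ y - φ x) ^ 2)
        ≤ ENNReal.ofReal ((Real.pi / 2) * ∫ θ in (0 : ℝ)..(Real.pi / 2), K (x, y) θ) :=
          ENNReal.ofReal_le_ofReal h
      _ = ENNReal.ofReal (Real.pi / 2) * ∫⁻ θ in Ioc 0 (Real.pi / 2), ENNReal.ofReal (K (x, y) θ) := by
          rw [ENNReal.ofReal_mul hpi2, intervalIntegral.integral_of_le hpi2,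
            ofReal_integral_eq_lintegral_ofReal (hc.integrableOn_Icc.mono_set Ioc_subset_Icc_self)
              (ae_of_all _ fun θ => hK0 _ _)]
  -- Step 2: integrate in `(x, y)` and swap with `θ`
  have h2 : ∫⁻ x, ∫⁻ y, ENNReal.ofReal ((φ x - φ y) ^ 2) ∂G ∂G ≤
      ENNReal.ofReal (Real.pi / 2) *
        ∫⁻ θ in Ioc 0 (Real.pi / 2), ∫⁻ z, ENNReal.ofReal (K z θ) ∂(G.prod G) := by
    have hF : Measurable fun z : (Fin n → ℝ) × (Fin n → ℝ) =>
        ∫⁻ θ in Ioc 0 (Real.pi / 2), ENNReal.ofReal (K z θ) := hKm.lintegral_prod_right'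
    calc ∫⁻ x, ∫⁻ y, ENNReal.ofReal ((φ x - φ y) ^ 2) ∂G ∂G
        ≤ ∫⁻ x, ∫⁻ y, ENNReal.ofReal (Real.pi / 2) *
            (∫⁻ θ in Ioc 0 (Real.pi / 2), ENNReal.ofReal (K (x, y) θ)) ∂G ∂G :=
          lintegral_mono fun x => lintegral_mono fun y => h1 x y
      _ = ∫⁻ z, ENNReal.ofReal (Real.pi / 2) *
            (∫⁻ θ in Ioc 0 (Real.pi / 2), ENNReal.ofReal (K z θ)) ∂(G.prod G) :=
          (lintegral_prod (fun z => ENNReal.ofReal (Real.pi / 2) *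
            ∫⁻ θ in Ioc 0 (Real.pi / 2), ENNReal.ofReal (K z θ)) (hF.const_mul _).aemeasurable).symm
      _ = ENNReal.ofReal (Real.pi / 2) *
            ∫⁻ θ in Ioc 0 (Real.pi / 2), ∫⁻ z, ENNReal.ofReal (K z θ) ∂(G.prod G) := by
          rw [lintegral_const_mul _ hF, lintegral_lintegral_swap hKm.aemeasurable]
  -- Step 3: rotation invariance and second moments, for each `θ`
  have h3 : ∀ θ, ∫⁻ z, ENNReal.ofReal (K z θ) ∂(G.prod G) =
      ENNReal.ofReal v * ∫⁻ x, ENNReal.ofReal (∑ i, (fderiv ℝ φ x (Pi.single i 1)) ^ 2) ∂G := by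
    intro θ
    rw [hG, ← lintegral_sq_fderiv_prod v hφ, ← lintegral_sq_fderiv_rotatePath v hφ θ]
    simp_rw [hK]
  simp_rw [h3] at h2
  rw [setLIntegral_const, Real.volume_Ioc, sub_zero] at h2
  refine h2.trans (le_of_eq ?_)
  rw [show Real.pi ^ 2 / 4 * (v : ℝ) = (Real.pi / 2) * ((v : ℝ) * (Real.pi / 2)) by ring,
    ENNReal.ofReal_mul hpi2, ENNReal.ofReal_mul v.coe_nonneg]
  ring

end Literature.Probability.Distributions

end
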